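import Summits.MatrixMultiplication.MatrixMultiplication.Theorems.EdgePencilRungPrice
import HarnessLib

/-!
# The terminal slope `σ(K₄)` of the sixth-edge ladder: the second shape coordinate of the crux, its laws,
# its price, and the continuum of internal cuts between the two stubs of «rung-and-chord»

Helper kernel for `stmt-MatrixMultiplication-26697` (`TetraExcessZero : ω(K₄) ≤ ω(2,1,2)`, attacked leaf of route
`TetrahedronCarving`; cut of record `closes (hA : TetraExcessZero) (hB : TetraPlusTwo)`, UNCHANGED; lineage
`decomp-mm-lens-6` «barrier-complement carving», generation 39). No item added or changed; one new real quantity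
`tetraSigma` (with its set `slopeCaps`), one new `SixWorld` family `slopeWorld`, no `Prop`-valued definition.
Notation of `EdgePencilSixthLadder`/`…SixthAlpha`/`…RungPrice`: `χ = omegaSix` (convex, non-decreasing on `[0,1]`,
`χ(0) = ψ = ω(2,1,2)`, `χ(1) = T = ω(K₄)`), `α(K₄) = tetraAlpha` (`χ` is flat exactly on `[0, α(K₄)]`),
`B_c : 4 + c(ω−2) ≤ T` (`B_1 = TetraPlusTwo`), `κ(a) = (1−2a)/(1−a)` (`ψ − 4 ≤ κ(a)(ω−2)`; floor `0.792`, record `0.5267`).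

THE OBJECT. `σ(K₄) := inf {s ≥ 0 : ∀ δ ∈ [0,1], T ≤ χ(δ) + s(1−δ)}` (`tetraSigma`): the TERMINAL SLOPE of the
ladder = the exponent-price per unit of log-bond of the LAST sliver of the sixth edge at the full tetrahedron
(`T(K₄)_n = W_n^{(n^δ)} ⊠₀₁ EPR(n^{1−δ})`, `δ → 1`); by convexity the supremum of the quotients `(T − χ(δ))/(1−δ)`
(`slope_le_tetraSigma`), attained (`omegaTetra_le_omegaSix_add_sigma`). Dual reading (informal; Strassen + Danskin):
`σ(K₄) = min {β₀₁(F) : F a K₄-maximal spectral point}`, `F(EPR₀₁(n)) = n^{β₀₁(F)}` — `α(K₄) > 0` is a statement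
about the DIAMOND's maximal face of the asymptotic spectrum, `σ(K₄)` about the TETRAHEDRON's.
* §2 LAWS (every field): `T − ψ ≤ σ ≤ 1`, `σ ≤ T/6` (symmetrisation; `< 0.7724` on the printed `T < 4.633908`), and the
  PRODUCT BOUND `T − ψ ≤ (1 − α(K₄))·σ(K₄)`: quantitative progress on the two shape coordinates multiplies.
* §3 SHAPE COORDINATES: `leaf ⟺ σ = 0` (so `σ = 0` is the crux, not a piece: costume check recorded),
  `MidTight ⟺ σ = T − ψ` (terminal slope at its FLOOR), `SixRungPos ⟺ α > 0` (g37): the registered line is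
  «`α > 0` ∧ `σ` minimal»; and `ω = 2 ⟺ σ(K₄) = 0 ∧ TetraPlusTwo`.
* §4 PRICE OF A SLOPE CAP: `σ ≤ s`, a rung at `a`, `B_c`, chord face `a'` ⟹ `(c − κ(a'))(ω−2) ≤ (1−a)s`
  (`slopePrice`; floor / record forms); over `ℂ`: `TetraPlusTwo ⟹ 0.208(ω−2) ≤ (1 − α(K₄))σ(K₄)`; NEWS THRESHOLD on
  the record: `(1−a)s < 0.1758` beats `ω ≤ 2.371552` (`omega_lt_of_slopeCap_record`; the recorded `s = T/6` needs `a > 0.73`).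
* §5 INTERNAL CUTS: `Rung(δ₀) ∧ Chord_t(λ) ⟹ leaf` whenever `λ(1−δ₀) > t − δ₀` (`Chord_t(λ) : ψ + λ(T−ψ) ≤ χ(t)`;
  `excessZero_of_sixRung_of_chordAt`). The registered seam is the corner `δ₀ → 0⁺`, `t = λ = 1/2` (weakest rung,
  rigid chord); the OPPOSITE corner `leaf ⟺ Rung(1/2) ∧ ChordPos`, `ChordPos : ∃ λ > 0, ψ + λ(T−ψ) ≤ χ(1/2)`
  (strong rung, soft chord) is equally exact (`excessZero_iff_halfRung_and_chordPos`); the boundary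
  `λ(1−δ₀) = t − δ₀` does NOT suffice (`SixWorld.hinge`: `δ₀ = 1/2`, `λ = 2t−1`; `SixWorld.affine`: `δ₀ = 0`,
  `λ = t`); `ChordPos` is strictly below `MidTight` (`SixWorld.quadratic`, g25: `λ = 1/4`), undecided (`affine ⊨`, `hinge ⊭`).
* §6 EXACTNESS: the affine residual worlds `slopeWorld d` (`ω = 2+d`, `T = ω+2`, `ψ = 4 + 0.5267d`, `χ = ψ + 0.4733d·δ`)
  obey all six laws, the residual and the record chord with equality and `MidTight` (for `d ≤ 0.371552` also the
  printed `ω ≤ 2.371552`, `T ≤ 4.633908`, `ψ ≥ 5ω/3`, by `linarith`); terminal slope `T − ψ = 0.4733d`. So for every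
  `s ∈ (0, 0.9466]`: slope cap `s` ∧ stub 2 ∧ residual ∧ `ω = 2 + s/0.4733 > 2` (`slopeCap_midTight_residual_not_a_cut`)
  — the price of §4 is attained; a slope cap short of `0` closes nothing, even next to `MidTight`.

References: Christandl–Vrana–Zuiddam, arXiv:1609.07476, §1.2–1.3, §2.1 [ChristandlVranaZuiddam2016]; Lotti–Romani 1983,
§2–§3 [LottiRomani1983]; Strassen 1988, §1 [Strassen1988]; Coppersmith 1982, Thm. 1 [Coppersmith1982]; Vassilevska Williams–Xu–Xu–Zhou
2024, Thm. 1.2 [VassilevskaWilliamsXuXuZhou2024]; Brand et al. 2026, Thm. 48 [BrandEtAl2026]. Sorry-free; no new axiom, no instance, no notation.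
-/

noncomputable section
set_option linter.dupNamespace false

open Literature.Computability.AlgebraicComplexity
open Summit.MatrixMultiplication.MatrixMultiplication.Theorems.TetrahedronTensor
open Summit.MatrixMultiplication.MatrixMultiplication.Theses.TetrahedronCarving

namespace Summit.MatrixMultiplication.MatrixMultiplication.Theorems.EdgePencil

/-! ## §1 The terminal slope -/

section Ladder
variable (F : Type) [Field F]

/-- Slope caps: `s ≥ 0` with `ω(K₄) ≤ χ(δ) + s(1 − δ)` for all `δ ∈ [0,1]`. -/
def slopeCaps : Set ℝ :=
  {s : ℝ | 0 ≤ s ∧ ∀ δ : ℝ, 0 ≤ δ → δ ≤ 1 → omegaTetra F ≤ omegaSix F δ + s * (1 - δ)}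

/-- **`σ(K₄)`**, the terminal slope of the sixth-edge ladder: the least slope cap. -/
def tetraSigma : ℝ := sInf (slopeCaps F)

/-- `1` is a slope cap (padding `ω(K₄) ≤ χ(δ) + 1 − δ`). [cite: ChristandlVranaZuiddam2016, Prop. 1.1.26] -/
theorem one_mem_slopeCaps : (1 : ℝ) ∈ slopeCaps F :=
  ⟨zero_le_one, fun δ _ h1 => by simpa using omegaTetra_le_omegaSix_add F h1⟩

/-- Slope caps exist. -/
theorem slopeCaps_nonempty : (slopeCaps F).Nonempty := ⟨1, one_mem_slopeCaps F⟩
/-- Slope caps are `≥ 0`. -/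
theorem slopeCaps_bddBelow : BddBelow (slopeCaps F) := ⟨0, fun _ hs => hs.1⟩
/-- `0 ≤ σ(K₄)`. -/
theorem tetraSigma_nonneg : 0 ≤ tetraSigma F := le_csInf (slopeCaps_nonempty F) fun _ hs => hs.1

/-- Introduction rule: any `s ≥ 0` with `ω(K₄) ≤ χ(δ) + s(1−δ)` on `[0,1]` bounds `σ(K₄)`. -/
theorem tetraSigma_le_of_forall {s : ℝ} (hs0 : 0 ≤ s)
    (h : ∀ δ : ℝ, 0 ≤ δ → δ ≤ 1 → omegaTetra F ≤ omegaSix F δ + s * (1 - δ)) : tetraSigma F ≤ s :=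
  csInf_le (slopeCaps_bddBelow F) ⟨hs0, h⟩

/-- `σ(K₄) ≤ 1`. [cite: ChristandlVranaZuiddam2016, Prop. 1.1.26] -/
theorem tetraSigma_le_one : tetraSigma F ≤ 1 :=
  csInf_le (slopeCaps_bddBelow F) (one_mem_slopeCaps F)

/-- **The infimum is attained**: `ω(K₄) ≤ χ(δ) + σ(K₄)·(1 − δ)` for `δ ∈ [0,1]`. -/
theorem omegaTetra_le_omegaSix_add_sigma {δ : ℝ} (h0 : 0 ≤ δ) (h1 : δ ≤ 1) :
    omegaTetra F ≤ omegaSix F δ + tetraSigma F * (1 - δ) := by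
  refine le_of_forall_pos_le_add fun ε hε => ?_
  obtain ⟨s, hs, hslt⟩ := exists_lt_of_csInf_lt (slopeCaps_nonempty F)
    (lt_add_of_pos_right (tetraSigma F) hε)
  have h := hs.2 δ h0 h1
  have hm : s * (1 - δ) ≤ (tetraSigma F + ε) * (1 - δ) :=
    mul_le_mul_of_nonneg_right hslt.le (sub_nonneg.2 h1)
  have hε' : 0 ≤ ε * δ := mul_nonneg hε.le h0
  nlinarith

/-- **`σ(K₄)` dominates every difference quotient**: `(ω(K₄) − χ(δ))/(1 − δ) ≤ σ(K₄)` for `0 ≤ δ < 1`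
(by convexity the quotients increase to `σ(K₄)` as `δ → 1`). [cite: LottiRomani1983, §2 (p. 174)] -/
theorem slope_le_tetraSigma {δ : ℝ} (h0 : 0 ≤ δ) (h1 : δ < 1) :
    (omegaTetra F - omegaSix F δ) / (1 - δ) ≤ tetraSigma F := by
  rw [div_le_iff₀ (sub_pos.2 h1)]
  linarith [omegaTetra_le_omegaSix_add_sigma F h0 h1.le]

/-! ## §2 Laws: `T − ψ ≤ σ ≤ min(1, T/6)` and the product bound -/

/-- **`ω(K₄) − ω(2,1,2) ≤ σ(K₄)`** (the quotient at `δ = 0`: the average slope is at most the terminal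
slope). [cite: LottiRomani1983, §2 (p. 174)] -/
theorem excess_le_tetraSigma : omegaTetra F - omegaRect F 2 1 2 ≤ tetraSigma F := by
  have h := omegaTetra_le_omegaSix_add_sigma F le_rfl zero_le_one
  rw [omegaSix_zero] at h
  linarith

/-- **`σ(K₄) ≤ ω(K₄)/6`** (symmetrisation: `ω(K₄) − χ(δ) ≤ (1 − δ)·ω(K₄)/6`). In the dual reading: some
K₄-maximal spectral point has its smallest edge exponent at most the average `ω(K₄)/6`.
[cite: ChristandlVranaZuiddam2016, §2.1 (nonuniformsymm)] -/
theorem tetraSigma_le_sixth : tetraSigma F ≤ omegaTetra F / 6 := by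
  refine tetraSigma_le_of_forall F (by linarith [four_le_omegaTetra F]) fun δ h0 h1 => ?_
  have h := (omegaTetra_sub_omegaSix_le F h0 h1).1
  have : (1 - δ) / 6 * omegaTetra F = omegaTetra F / 6 * (1 - δ) := by ring
  linarith

/-- On the printed `ω(K₄) < 4.633908` (hypothesis; Brand et al. 2026, Thm. 48): `σ(K₄) < 0.7724`. (In the tree,
`ω(K₄) ≤ 2ω < 4.7744` by `CoppersmithWinograd1990_sec7_omega_lt` gives `σ(K₄)(ℂ) < 0.7958`.) [cite: BrandEtAl2026, Thm. 48] -/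
theorem tetraSigma_lt_record (hT : omegaTetra F < 4.633908) : tetraSigma F < 0.7724 := by
  have h := tetraSigma_le_sixth F
  linarith

/-- **THE PRODUCT BOUND**: `ω(K₄) − ω(2,1,2) ≤ (1 − α(K₄))·σ(K₄)` — the excess is at most
«length of the non-flat part × terminal slope». [cite: LottiRomani1983, §2 (p. 174)] -/
theorem excess_le_one_sub_tetraAlpha_mul_sigma :
    omegaTetra F - omegaRect F 2 1 2 ≤ (1 - tetraAlpha F) * tetraSigma F := by
  have h := omegaTetra_le_omegaSix_add_sigma F (tetraAlpha_nonneg F) (tetraAlpha_le_one F)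
  rw [omegaSix_tetraAlpha] at h
  linarith [mul_comm (1 - tetraAlpha F) (tetraSigma F)]

/-- … with an explicit rung and a slope cap: `χ(a) ≤ ω(2,1,2)` (`a ∈ [0,1]`), `σ(K₄) ≤ s` ⟹
`ω(K₄) − ω(2,1,2) ≤ (1 − a)·s`. [cite: LottiRomani1983, §2 (p. 174)] -/
theorem excess_le_of_sixRung_of_slopeCap {a s : ℝ} (ha0 : 0 ≤ a) (ha1 : a ≤ 1)
    (hr : omegaSix F a ≤ omegaRect F 2 1 2) (hs : tetraSigma F ≤ s) :
    omegaTetra F - omegaRect F 2 1 2 ≤ (1 - a) * s := by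
  have h := omegaTetra_le_omegaSix_add_sigma F ha0 ha1
  nlinarith [mul_le_mul_of_nonneg_left hs (sub_nonneg.2 ha1)]

/-! ## §3 The crux and the two stubs in shape coordinates -/

/-- **leaf ⟺ `σ(K₄) = 0`**: `ω(K₄) ≤ ω(2,1,2)` iff the terminal slope vanishes (a convex non-decreasing
function with zero terminal slope is constant). So `σ = 0` is the CRUX itself, not a piece of it.
[cite: LottiRomani1983, §2 (p. 174)] -/
theorem excessZero_iff_tetraSigma_eq_zero :
    omegaTetra F ≤ omegaRect F 2 1 2 ↔ tetraSigma F = 0 := by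
  refine ⟨fun hE => le_antisymm (tetraSigma_le_of_forall F le_rfl fun δ _ _ => ?_) (tetraSigma_nonneg F),
    fun h => by linarith [excess_le_tetraSigma F]⟩
  linarith [omegaRect_two_one_two_le_omegaSix F δ]

/-- **MidTight ⟺ `σ(K₄) = ω(K₄) − ω(2,1,2)`** (the terminal slope at its floor, the average slope: a
convex function whose maximal slope equals its average slope is affine). The chord stub of the registered
line fixes the SECOND shape coordinate; the rung stub (`α(K₄) > 0`) the first. [cite: LottiRomani1983, §2 (p. 174)] -/
theorem midTight_iff_tetraSigma_eq_excess :
    omegaRect F 2 1 2 + omegaTetra F ≤ 2 * omegaSix F (1 / 2) ↔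
      tetraSigma F = omegaTetra F - omegaRect F 2 1 2 := by
  constructor
  · intro hmid
    refine le_antisymm (tetraSigma_le_of_forall F
      (sub_nonneg.2 (omegaRect_two_one_two_le_omegaTetra F)) fun δ h0 h1 => ?_) (excess_le_tetraSigma F)
    have hk := noKink_of_midTight F hmid h0 h1
    have : (omegaTetra F - omegaRect F 2 1 2) * (1 - δ) =
        omegaTetra F - ((1 - δ) * omegaRect F 2 1 2 + δ * omegaTetra F) := by ring
    linarith
  · intro hσ
    have h := omegaTetra_le_omegaSix_add_sigma F (by norm_num : (0 : ℝ) ≤ 1 / 2) (by norm_num)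
    rw [hσ] at h
    linarith

/-- By name over `ℂ`: `TetraExcessZero ⟺ σ(K₄) = 0`. -/
theorem tetraExcessZero_iff_tetraSigma_eq_zero : TetraExcessZero ↔ tetraSigma ℂ = 0 :=
  excessZero_iff_tetraSigma_eq_zero ℂ

/-- NEC: `ω = 2 ⟹ σ(K₄) = 0` (every slope cap `σ ≤ s` is a necessary condition for the summit). -/
theorem tetraSigma_eq_zero_of_matrixMultiplication (hS : _root_.MatrixMultiplication) : tetraSigma ℂ = 0 :=
  (excessZero_iff_tetraSigma_eq_zero ℂ).1 (excessZero_of_matrixMultiplication hS)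

/-- The cut of record in shape coordinates: `ω = 2 ⟺ σ(K₄) = 0 ∧ TetraPlusTwo`. -/
theorem matrixMultiplication_iff_tetraSigma_eq_zero_and_tetraPlusTwo :
    _root_.MatrixMultiplication ↔ tetraSigma ℂ = 0 ∧ TetraPlusTwo := by
  rw [← tetraExcessZero_iff_tetraSigma_eq_zero]
  exact matrixMultiplication_iff_excessZero_and_plusTwo'

/-! ## §4 The price of a slope cap -/

/-- **THE PRICE OF A SLOPE CAP** (every field): a rung at `a ∈ [0,1]`, `σ(K₄) ≤ s`, a residual notch
`B_c : 4 + c(ω − 2) ≤ ω(K₄)` and the chord face at `a' ≤ min(α, 1/2)` give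
`(c − κ(a'))·(ω − 2) ≤ (1 − a)·s`. At `s = 0` or `a = 1` it is the cut of record.
[cite: LottiRomani1983, §3] [cite: ChristandlVranaZuiddam2016, §1.3] -/
theorem slopePrice {a s c a' : ℝ} (ha0 : 0 ≤ a) (ha1 : a ≤ 1) (hr : omegaSix F a ≤ omegaRect F 2 1 2)
    (hs : tetraSigma F ≤ s) (hB : 4 + c * (omega F - 2) ≤ omegaTetra F) (ha'0 : 0 ≤ a')
    (ha' : a' ≤ 1 / 2) (hα : a' ≤ dualExponentAlpha F) :
    (c - (1 - 2 * a') / (1 - a')) * (omega F - 2) ≤ (1 - a) * s := by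
  have h := excess_le_of_sixRung_of_slopeCap F ha0 ha1 hr hs
  have hρ := rectDefect_le_kappa_mul_defect F ha'0 ha' hα
  set κ := (1 - 2 * a') / (1 - a')
  linarith

/-- On the tree floor (`α > 0.1722`, PROVED): `(c − 0.792)·(ω − 2) ≤ (1 − a)·s`. [cite: Coppersmith1982, Thm. 1] -/
theorem slopePrice_floor {a s c : ℝ} (ha0 : 0 ≤ a) (ha1 : a ≤ 1) (hr : omegaSix F a ≤ omegaRect F 2 1 2)
    (hs : tetraSigma F ≤ s) (hB : 4 + c * (omega F - 2) ≤ omegaTetra F) :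
    (c - 0.792) * (omega F - 2) ≤ (1 - a) * s := by
  have h := slopePrice F ha0 ha1 hr hs hB (by norm_num) (by norm_num)
    (coppersmithFloor_le_dualExponentAlpha F)
  have hκ := kappa_coppersmithFloor_lt
  have hd := defect_nonneg F
  nlinarith [mul_le_mul_of_nonneg_right hκ.le hd]

/-- On the printed record `α ≥ 0.3213` (hypothesis): `(c − 0.5267)·(ω − 2) ≤ (1 − a)·s`.
[cite: VassilevskaWilliamsXuXuZhou2024, Thm. 1.2] -/
theorem slopePrice_record (hα : (0.3213 : ℝ) ≤ dualExponentAlpha F) {a s c : ℝ} (ha0 : 0 ≤ a)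
    (ha1 : a ≤ 1) (hr : omegaSix F a ≤ omegaRect F 2 1 2) (hs : tetraSigma F ≤ s)
    (hB : 4 + c * (omega F - 2) ≤ omegaTetra F) :
    (c - 0.5267) * (omega F - 2) ≤ (1 - a) * s := by
  have h := slopePrice F ha0 ha1 hr hs hB (by norm_num) (by norm_num) hα
  have hκ : (1 - 2 * (0.3213 : ℝ)) / (1 - 0.3213) < 0.5267 := by
    rw [div_lt_iff₀ (by norm_num)]
    norm_num
  have hd := defect_nonneg F
  nlinarith [mul_le_mul_of_nonneg_right hκ.le hd]

/-- **By name over `ℂ`**: `TetraPlusTwo ⟹ 0.208·(ω − 2) ≤ (1 − α(K₄))·σ(K₄)`. [cite: Coppersmith1982, Thm. 1] -/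
theorem omega_price_shape (hB : TetraPlusTwo) :
    0.208 * (omega ℂ - 2) ≤ (1 - tetraAlpha ℂ) * tetraSigma ℂ := by
  have h := slopePrice_floor ℂ (tetraAlpha_nonneg ℂ) (tetraAlpha_le_one ℂ) (omegaSix_tetraAlpha ℂ).le
    le_rfl (residual_of_tetraPlusTwo hB)
  linarith

/-- **NEWS THRESHOLD on the record**: with `α ≥ 0.3213` and `TetraPlusTwo`, a rung at `a` and a slope cap
`s` with `(1 − a)·s < 0.1758` beat the printed `ω ≤ 2.371552` (the recorded cap `s = ω(K₄)/6 ≥ 2/3` needs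
`a > 0.73`; a cap `s < 0.1758` would be news with no rung). [cite: VassilevskaWilliamsXuXuZhou2024, Thm. 1.2] -/
theorem omega_lt_of_slopeCap_record (hα : (0.3213 : ℝ) ≤ dualExponentAlpha ℂ) (hB : TetraPlusTwo)
    {a s : ℝ} (ha0 : 0 ≤ a) (ha1 : a ≤ 1) (hr : omegaSix ℂ a ≤ omegaRect ℂ 2 1 2)
    (hs : tetraSigma ℂ ≤ s) (hnews : (1 - a) * s < 0.1758) : omega ℂ < 2.371552 := by
  have h := slopePrice_record ℂ hα ha0 ha1 hr hs (residual_of_tetraPlusTwo hB)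
  linarith

/-! ## §5 The continuum of internal cuts between the two stubs -/

/-- **Rung × chord**: a rung at `δ₀` (`χ(δ₀) ≤ ω(2,1,2)`) and a chord bound at `t ∈ [δ₀, 1]`
(`ω(2,1,2) + λ·(ω(K₄) − ω(2,1,2)) ≤ χ(t)`) give the leaf as soon as `λ(1 − δ₀) > t − δ₀`
(three-point convexity on `δ₀ ≤ t ≤ 1`). The registered seam `excessZero_of_sixRungPos_of_midTight` is
the corner `t = λ = 1/2`, `δ₀ > 0`. [cite: LottiRomani1983, §2 (p. 174)] -/
theorem excessZero_of_sixRung_of_chordAt {δ₀ t l : ℝ} (h0 : 0 ≤ δ₀) (hδt : δ₀ ≤ t) (ht1 : t ≤ 1)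
    (hδ1 : δ₀ < 1) (hl : t - δ₀ < l * (1 - δ₀)) (hrung : omegaSix F δ₀ ≤ omegaRect F 2 1 2)
    (hchord : omegaRect F 2 1 2 + l * (omegaTetra F - omegaRect F 2 1 2) ≤ omegaSix F t) :
    omegaTetra F ≤ omegaRect F 2 1 2 := by
  have h3 := omegaSix_three_point F h0 hδt ht1 le_rfl hδ1
  rw [omegaSix_one] at h3
  have hψ := omegaRect_two_one_two_le_omegaTetra F
  by_contra hne
  have hpos : 0 < omegaTetra F - omegaRect F 2 1 2 := by linarith
  have h1t : 0 ≤ 1 - t := sub_nonneg.2 ht1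
  have hm := mul_le_mul_of_nonneg_left hrung h1t
  have key : (l * (1 - δ₀) - (t - δ₀)) * (omegaTetra F - omegaRect F 2 1 2) ≤ 0 := by nlinarith
  have := mul_pos (sub_pos.2 hl) hpos
  linarith

/-- The monotone case `t ≤ δ₀`: a chord bound with `λ > 0` at or below a rung is the leaf outright. -/
theorem excessZero_of_sixRung_of_chordAt_le {δ₀ t l : ℝ} (htδ : t ≤ δ₀) (hl : 0 < l)
    (hrung : omegaSix F δ₀ ≤ omegaRect F 2 1 2)
    (hchord : omegaRect F 2 1 2 + l * (omegaTetra F - omegaRect F 2 1 2) ≤ omegaSix F t) :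
    omegaTetra F ≤ omegaRect F 2 1 2 := by
  have h := (hchord.trans (omegaSix_mono F htδ)).trans hrung
  nlinarith

/-- **The opposite corner is an exact split too**: `leaf ⟺ Rung(1/2) ∧ ChordPos` with
`ChordPos : ∃ λ > 0, ω(2,1,2) + λ(ω(K₄) − ω(2,1,2)) ≤ χ(1/2)` («half an edge costs a positive FRACTION
of the full edge, relative to the diamond») — a STRONGER rung and a SOFTER chord than the registered
`SixRungPos ∧ MidTight`. [cite: LottiRomani1983, §2 (p. 174)] -/
theorem excessZero_iff_halfRung_and_chordPos :
    omegaTetra F ≤ omegaRect F 2 1 2 ↔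
      omegaSix F (1 / 2) ≤ omegaRect F 2 1 2 ∧
        ∃ l : ℝ, 0 < l ∧ omegaRect F 2 1 2 + l * (omegaTetra F - omegaRect F 2 1 2) ≤ omegaSix F (1 / 2) := by
  refine ⟨fun hE => ⟨sixRung_of_excessZero F hE _, 1, one_pos, ?_⟩, fun ⟨hr, l, hl, hc⟩ => ?_⟩
  · have := omegaRect_two_one_two_le_omegaSix F (1 / 2)
    linarith
  · exact excessZero_of_sixRung_of_chordAt_le F le_rfl hl hr hc

/-- By name over `ℂ`: `TetraExcessZero ⟺ χ(1/2) ≤ ω(2,1,2) ∧ ChordPos`. -/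
theorem tetraExcessZero_iff_halfRung_and_chordPos :
    TetraExcessZero ↔
      omegaSix ℂ (1 / 2) ≤ omegaRect ℂ 2 1 2 ∧
        ∃ l : ℝ, 0 < l ∧ omegaRect ℂ 2 1 2 + l * (omegaTetra ℂ - omegaRect ℂ 2 1 2) ≤ omegaSix ℂ (1 / 2) :=
  excessZero_iff_halfRung_and_chordPos ℂ

end Ladder

namespace SixWorld

/-- **The boundary `λ(1 − δ₀) = t − δ₀` does not suffice, I**: in the hinge world (rung at `δ₀ = 1/2`)
the chord bound at `t ∈ [1/2, 1]` holds with `λ = 2t − 1` exactly, and the leaf fails; at `t = 1/2` this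
is `Rung(1/2) ∧ ¬ChordPos`. -/
theorem hinge_chord_boundary {t : ℝ} (_ht : 1 / 2 ≤ t) (_ht1 : t ≤ 1) :
    hinge.chi (1 / 2) ≤ hinge.psi ∧ hinge.psi + (2 * t - 1) * (hinge.tet - hinge.psi) ≤ hinge.chi t ∧
      ¬ hinge.tet ≤ hinge.psi ∧
        ¬ ∃ l : ℝ, 0 < l ∧ hinge.psi + l * (hinge.tet - hinge.psi) ≤ hinge.chi (1 / 2) := by
  refine ⟨by norm_num [hinge], ?_, by norm_num [hinge], ?_⟩
  · show (4.08 : ℝ) + (2 * t - 1) * (4.3 - 4.08) ≤ max 4.08 (3.86 + 0.44 * t)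
    have := le_max_right (4.08 : ℝ) (3.86 + 0.44 * t)
    nlinarith
  · rintro ⟨l, hl, h⟩
    norm_num [hinge] at h
    linarith

/-- **The boundary does not suffice, II**: in the affine world (no rung, `δ₀ = 0`) the chord bound at every
`t ∈ [0,1]` holds with `λ = t` exactly (so `ChordPos` and `MidTight` hold), and the leaf fails. -/
theorem affine_chord_boundary {t : ℝ} (_ht0 : 0 ≤ t) (_ht1 : t ≤ 1) :
    affine.psi + t * (affine.tet - affine.psi) ≤ affine.chi t ∧ ¬ affine.tet ≤ affine.psi := by
  refine ⟨?_, by norm_num [affine]⟩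
  show (4.08 : ℝ) + t * (4.4 - 4.08) ≤ 4.08 + 0.32 * t
  nlinarith

/-! ## §6 Exactness: the affine residual worlds -/

/-- **The affine residual worlds** `slopeWorld d` (`0 ≤ d ≤ 2`): `ω = 2 + d`, `ψ = 4 + 0.5267d`,
`T = 4 + d = ω + 2`, `χ(δ) = ψ + 0.4733d·δ`. All six laws hold (symmetrisation: `1.8398d(1−δ) ≤ 4(1−δ)`),
the residual and the record chord hold with EQUALITY, `χ` is affine (`MidTight`), `α(K₄) = 0` for `d > 0`,
and the terminal slope is `T − ψ = 0.4733d`. (Compare `symmWorld d` of `EdgePencilRungPrice`: same ends,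
kinked ladder `max(ψ, (5+δ)T/6)`, terminal slope `T/6`.) -/
def slopeWorld (d : ℝ) (hd0 : 0 ≤ d) (hd2 : d ≤ 2) : SixWorld where
  om := 2 + d
  psi := 4 + 0.5267 * d
  tet := 4 + d
  chi := fun δ => 4 + 0.5267 * d + 0.4733 * d * δ
  chi_zero := by ring
  chi_one := by ring
  two_le_om := by linarith
  four_le_psi := by nlinarith
  psi_le_cover := by nlinarith
  tet_le_two_mul := by linarith
  kappa := by nlinarith
  mono := fun δ δ' _ h _ => by nlinarith [mul_le_mul_of_nonneg_left h hd0]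
  convex := by
    refine ⟨convex_Icc 0 1, fun x _ y _ p q _ _ hpq => ?_⟩
    simp only [smul_eq_mul]
    have : (4 + 0.5267 * d + 0.4733 * d * (p * x + q * y) : ℝ) =
        p * (4 + 0.5267 * d + 0.4733 * d * x) + q * (4 + 0.5267 * d + 0.4733 * d * y) := by
      linear_combination (4 + 0.5267 * d : ℝ) * hpq.symm
    exact this.le
  block := fun δ h0 h1 => by nlinarith [mul_le_mul_of_nonneg_left hd2 h0]
  top := fun δ h0 h1 => by nlinarith [mul_le_mul_of_nonneg_left hd2 (sub_nonneg.2 h1)]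
  symm := fun δ h0 h1 => by nlinarith [mul_le_mul_of_nonneg_left hd2 (sub_nonneg.2 h1)]

variable {d : ℝ} (hd0 : 0 ≤ d) (hd2 : d ≤ 2)

/-- Residual and record chord (equalities), `MidTight`, and the sharp slope cap `0.4733d` in `slopeWorld d`. -/
theorem slopeWorld_recorded :
    (slopeWorld d hd0 hd2).om + 2 = (slopeWorld d hd0 hd2).tet ∧
      (slopeWorld d hd0 hd2).psi - 4 = 0.5267 * ((slopeWorld d hd0 hd2).om - 2) ∧
        (slopeWorld d hd0 hd2).psi + (slopeWorld d hd0 hd2).tet ≤ 2 * (slopeWorld d hd0 hd2).chi (1 / 2) ∧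
          (∀ δ : ℝ, 0 ≤ δ → δ ≤ 1 →
            (slopeWorld d hd0 hd2).tet ≤ (slopeWorld d hd0 hd2).chi δ + 0.4733 * d * (1 - δ)) ∧
            ∀ s : ℝ, (∀ δ : ℝ, 0 ≤ δ → δ ≤ 1 →
              (slopeWorld d hd0 hd2).tet ≤ (slopeWorld d hd0 hd2).chi δ + s * (1 - δ)) → 0.4733 * d ≤ s := by
  refine ⟨by simp only [slopeWorld]; ring, by simp only [slopeWorld]; ring, ?_, fun δ _ _ => ?_, fun s hs => ?_⟩
  · show (4 + 0.5267 * d + (4 + d) : ℝ) ≤ 2 * (4 + 0.5267 * d + 0.4733 * d * (1 / 2))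
    nlinarith
  · show (4 + d : ℝ) ≤ 4 + 0.5267 * d + 0.4733 * d * δ + 0.4733 * d * (1 - δ)
    nlinarith
  · have h := hs 0 le_rfl zero_le_one
    simp only [slopeWorld] at h
    linarith

/-- **A slope cap, even next to `MidTight` and the residual, is not a cut**: for every `s ∈ (0, 0.9466]`
there is a law-consistent world with slope cap `s`, `MidTight` (stub 2 of the registered line), the residual
`TetraPlusTwo` and the record chord with equality, and `ω = 2 + s/0.4733 > 2`; the price
`0.4733(ω − 2) ≤ s` of §4 (`a = 0`) is attained. -/
theorem slopeCap_midTight_residual_not_a_cut {s : ℝ} (hs0 : 0 < s) (hs1 : s ≤ 0.9466) :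
    ∃ W : SixWorld, (∀ δ : ℝ, 0 ≤ δ → δ ≤ 1 → W.tet ≤ W.chi δ + s * (1 - δ)) ∧
      W.psi + W.tet ≤ 2 * W.chi (1 / 2) ∧ W.om + 2 = W.tet ∧
      W.psi - 4 = 0.5267 * (W.om - 2) ∧ 2 < W.om ∧ 0.4733 * (W.om - 2) = s := by
  have hd0 : 0 ≤ s / 0.4733 := by positivity
  have hd2 : s / 0.4733 ≤ 2 := by rw [div_le_iff₀ (by norm_num)]; linarith
  obtain ⟨h1, h2, h3, h4, -⟩ := slopeWorld_recorded hd0 hd2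
  refine ⟨slopeWorld (s / 0.4733) hd0 hd2, ?_, h3, h1, h2, ?_, ?_⟩
  · have : 0.4733 * (s / 0.4733) = s := by field_simp
    rwa [this] at h4
  · show (2 : ℝ) < 2 + s / 0.4733
    linarith [show 0 < s / 0.4733 by positivity]
  · show 0.4733 * (2 + s / 0.4733 - 2) = s
    field_simp
    ring

end SixWorld

end Summit.MatrixMultiplication.MatrixMultiplication.Theorems.EdgePencil

end
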